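import Mathlib.NumberTheory.Transcendental.Liouville.LiouvilleNumber
import Mathlib.NumberTheory.Transcendental.Liouville.LiouvilleWith
import Mathlib.Analysis.Complex.ExponentialBounds
import Summits.KontsevichZagierPeriods.Zeta5Search.MeasureRecords
import HarnessLib

/-!
# ζ(5) search — criteria: SPARSE small forms bound nothing (cell `pub-zeta5`, family `odd`, print watch)

HONEST FRAMING: systematic search; no irrationality claim unless certified.

Companion of `Criteria.lean` (C1), `CriteriaNesterenko.lean` (C2), `EffectiveMeasure.lean` /
`MeasureHata.lean` (C4) and `CriteriaOneOfMeasure.lean`.  Those criteria turn integer linear forms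
`A n + B n ξ` into an irrationality EXPONENT bound only under a hypothesis that ties CONSECUTIVE indices
together: an exact / two-sided rate of the forms or of the coefficients at EVERY large `n`
(`Literature.NumberTheory.DiophantineApproximation.NesterenkoCriterion.nesterenko_criterion`,
`Literature.NumberTheory.Irrationality.Hata1993.remark_2_1` via `ExponentLE.of_hata_rates`), or
consecutive non-proportionality (`not_liouvilleWith_of_eventual_rates`).  This file records, as a
theorem, that the hypothesis cannot be dropped: the following statement, printed as

> **(Morris 2025, Theorem 2) ("Nesterenko's criterion, cf. [5]").** Let `α ∈ ℝ`. Assume there exist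
> sequences of integers `Aₙ` and `Bₙ` such that (•) `Bₙ ≠ 0` for infinitely many `n`; (•) there exist
> constants `γ_A, γ_B > 0` such that `|Aₙ + Bₙ α| < e^{-γ_A n}` and `max(|Aₙ|, |Bₙ|) < e^{γ_B n}` for
> all sufficiently large `n`. Then `α ∉ 𝓛`, i.e. `μ(α) < ∞`. More precisely `μ(α) ≤ γ_A/(γ_A − γ_B)`.
> (Remark 1: "the condition `γ_A > γ_B` is essential".)

(S. A. Morris, *Each ζ(n), 5 ≤ n ≤ 25, is not a Liouville number*, Axioms **14** (2025) 546,
doi:10.3390/axioms14080546, p. 3; it is the only Diophantine input of that paper's Theorem 1 /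
Propositions 1–11, which assert `μ(ζ(n)) < ∞` for every odd `5 ≤ n ≤ 25`), is FALSE AS STATED, even
with the proviso `γ_A > γ_B`:

* `SparseForms.Hyp α γA γB` — the displayed hypotheses, verbatim (`∃ᶠ` = "for infinitely many `n`",
  `∀ᶠ` = "for all sufficiently large `n`");
* `SparseForms.hyp_liouvilleNumber` — Liouville's constant `ℓ₂ = ∑_{i ≥ 0} 2^{-i!}` (Mathlib
  `liouvilleNumber 2`) satisfies them with `γ_A = 3 > γ_B = 2`: put `(Aₙ, Bₙ) = (−pₖ, 2^{k!})` at the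
  indices `n = k!`, `k ≥ 6` (`pₖ / 2^{k!}` the `k`-th partial sum, so `0 < Aₙ + Bₙ ℓ₂ < 2^{-(k-1) n}
  ≤ 32^{-n} < e^{-3n}` by Mathlib `LiouvilleNumber.remainder_lt`, and `|Aₙ|, |Bₙ| < 2·2^n < e^{2n}`),
  and `(Aₙ, Bₙ) = (0, 0)` at every other `n`;
* `SparseForms.not_exponentLE_of_hyp`, `SparseForms.not_not_liouville_of_hyp`,
  `SparseForms.exists_hyp_and_liouville` — yet `ℓ₂` IS a Liouville number (Mathlib
  `liouville_liouvilleNumber`), so neither `μ(ℓ₂) ≤ γ_A/(γ_A − γ_B) = 3` (tree vocabulary: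
  `ExponentLE ℓ₂ 3`, `MeasureRecords.lean`) nor `μ(ℓ₂) < ∞` holds.

Consequence for the cell's literature census (FRESHNESS / LITERATURE, class `odd`): the printed claim
"`μ(ζ(n)) < ∞` for odd `5 ≤ n ≤ 25`" rests on a false lemma (and, independently, on unproved
assertions about "polynomially growing" elimination multipliers isolating a single `ζ(n)`, the priced
obstruction of this lane); its truth remains OPEN.  Nothing here is a claim about any `ζ(n)`.
Everything is PROVED (0 sorry, standard axioms); no named fact.
-/

noncomputable section

open Filter Topology
open LiouvilleNumber

namespace Summit.KontsevichZagierPeriods.Zeta5Search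

namespace SparseForms

/-! ### The printed statement -/

/-- The hypotheses of (Morris 2025, Theorem 2) for a real `α` and rates `γA, γB > 0`: integer sequences
`A n, B n` with `B n ≠ 0` for infinitely many `n`, and `|A n + B n α| < e^{-γA n}`,
`max (|A n|, |B n|) < e^{γB n}` for all sufficiently large `n` (Morris 2025, Theorem 2, p. 3, verbatim;
`∃ᶠ … in atTop` = "for infinitely many", `∀ᶠ … in atTop` = "for all sufficiently large"). -/
def Hyp (α γA γB : ℝ) : Prop :=
  0 < γA ∧ 0 < γB ∧ ∃ A B : ℕ → ℤ, (∃ᶠ n : ℕ in atTop, B n ≠ 0) ∧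
    ∀ᶠ n : ℕ in atTop, |(A n : ℝ) + B n * α| < Real.exp (-(γA * n)) ∧
      max (|(A n : ℝ)|) (|(B n : ℝ)|) < Real.exp (γB * n)

/-! The two conclusions asserted by (Morris 2025, Theorem 2) under the proviso `γB < γA` of its
Remark 1 are, in the tree's vocabulary: QUANTITATIVE `ExponentLE α (γA / (γA - γB))`
(`MeasureRecords.ExponentLE ξ κ = ∀ p > κ, ¬ LiouvilleWith p ξ`, i.e. `μ(α) ≤ γA/(γA-γB)`), and
QUALITATIVE `¬ Liouville α` ("`α ∉ 𝓛`, i.e. `μ(α) < ∞`").  Both are refuted below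
(`not_exponentLE_of_hyp`, `not_not_liouville_of_hyp`); they are stated inline, not as definitions. -/

/-! ### The witness: Liouville's constant in base 2 -/

/-- `ℓ₂ = ∑_{i ≥ 0} 2^{-i!}`, Liouville's constant in base `2`. [folklore] -/
def ell : ℝ := liouvilleNumber ((2 : ℕ) : ℝ)

/-- `ℓ₂` is a Liouville number (Mathlib). [folklore] -/
theorem liouville_ell : Liouville ell := liouville_liouvilleNumber le_rfl

/-- Denominators `d k = 2^{k!}` of the partial sums. [folklore] -/
def den (k : ℕ) : ℕ := 2 ^ k.factorial

/-- The `k`-th partial sum is `p / 2^{k!}` with `p ∈ ℕ` (Mathlib `partialSum_eq_rat`). [folklore] -/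
theorem exists_num (k : ℕ) : ∃ p : ℕ, partialSum ((2 : ℕ) : ℝ) k = p / (den k : ℝ) := by
  obtain ⟨p, hp⟩ := partialSum_eq_rat (m := 2) two_pos k
  exact ⟨p, by rw [hp, den, Nat.cast_pow]⟩

/-- Numerators `p k` of the partial sums: `partialSum 2 k = p k / 2^{k!}`. [folklore] -/
def num (k : ℕ) : ℕ := Classical.choose (exists_num k)

/-- The defining property of `num`: `partialSum 2 k = num k / den k`. [folklore] -/
theorem num_spec (k : ℕ) : partialSum ((2 : ℕ) : ℝ) k = num k / (den k : ℝ) :=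
  Classical.choose_spec (exists_num k)

/-- `den k > 0`. [folklore] -/
theorem den_pos (k : ℕ) : (0 : ℝ) < den k := Nat.cast_pos.2 (by unfold den; positivity)

/-- `1 ≤ den k`. [folklore] -/
theorem one_le_den (k : ℕ) : (1 : ℝ) ≤ den k := by
  exact_mod_cast (Nat.one_le_two_pow : 1 ≤ den k)

/-- The small divisors `s k = 2^{k!} ℓ₂ - p k`. [folklore] -/
def sd (k : ℕ) : ℝ := (den k : ℝ) * ell - num k

/-- `s k = 2^{k!} · (tail of ℓ₂ after k+1 terms)`. [folklore] -/
theorem sd_eq (k : ℕ) : sd k = den k * remainder ((2 : ℕ) : ℝ) k := by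
  have h := partialSum_add_remainder (m := ((2 : ℕ) : ℝ)) (by norm_num) k
  rw [sd, ell, ← h, num_spec, mul_add, mul_div_cancel₀ _ (den_pos k).ne']
  ring

/-- `s k > 0`. [folklore] -/
theorem sd_pos (k : ℕ) : 0 < sd k := by
  rw [sd_eq]; exact mul_pos (den_pos k) (remainder_pos (by norm_num) _)

/-- **Liouville's estimate** `s k < (2^{k!})^{-(k-1)}` (Mathlib `remainder_lt`). [folklore] -/
theorem sd_lt (k : ℕ) (hk : 1 ≤ k) : sd k < 1 / (den k : ℝ) ^ (k - 1) := by
  rw [sd_eq]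
  have h := remainder_lt k (m := ((2 : ℕ) : ℝ)) (by norm_num)
  have hb : ((2 : ℕ) : ℝ) ^ k.factorial = (den k : ℝ) := by rw [den, Nat.cast_pow]
  rw [hb] at h
  have hb0 := den_pos k
  obtain ⟨j, rfl⟩ : ∃ j, k = j + 1 := ⟨k - 1, by omega⟩
  calc (den (j + 1) : ℝ) * remainder ((2 : ℕ) : ℝ) (j + 1)
      < den (j + 1) * (1 / (den (j + 1) : ℝ) ^ (j + 1)) := mul_lt_mul_of_pos_left h hb0
    _ = 1 / (den (j + 1) : ℝ) ^ (j + 1 - 1) := by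
        rw [Nat.add_sub_cancel, pow_succ]; field_simp

/-- `ℓ₂ < 2` (indeed `ℓ₂ = 1/2 + (tail) < 1/2 + 1`). [folklore] -/
theorem ell_lt_two : ell < 2 := by
  have h := partialSum_add_remainder (m := ((2 : ℕ) : ℝ)) (by norm_num) 0
  have h0 : partialSum ((2 : ℕ) : ℝ) 0 = 1 / 2 := by simp [partialSum]
  have hr := remainder_lt 0 (m := ((2 : ℕ) : ℝ)) (by norm_num)
  rw [pow_zero] at hr
  rw [ell, ← h, h0]
  linarith

/-- `p k < 2 · 2^{k!}`. [folklore] -/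
theorem num_lt (k : ℕ) : (num k : ℝ) < 2 * den k := by
  have h1 := sd_pos k
  rw [sd] at h1
  have h2 := mul_lt_mul_of_pos_left ell_lt_two (den_pos k)
  linarith

/-! ### The sparse sequences -/

/-- `n` carries an approximation iff `n = k!` for some `k ≥ 6`. [folklore] -/
def IsIdx (n : ℕ) : Prop := ∃ k, 6 ≤ k ∧ k.factorial = n

open Classical in
/-- `B n = 2^n = 2^{k!}` at the indices `n = k!` (`k ≥ 6`), `B n = 0` elsewhere. [folklore] -/
def seqB (n : ℕ) : ℤ := if IsIdx n then 2 ^ n else 0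

open Classical in
/-- `A n = -p k` at the indices `n = k!` (`k ≥ 6`), `A n = 0` elsewhere. [folklore] -/
def seqA (n : ℕ) : ℤ := if h : IsIdx n then -(num (Classical.choose h) : ℤ) else 0

/-- `B n ≠ 0` for infinitely many `n` (namely at every `n = k!`, `k ≥ 6`). [folklore] -/
theorem seqB_frequently_ne_zero : ∃ᶠ n : ℕ in atTop, seqB n ≠ 0 := by
  refine frequently_atTop.2 fun a => ⟨(a + 6).factorial, ?_, ?_⟩
  · exact (Nat.le_add_right a 6).trans (Nat.self_le_factorial _)
  · have h : IsIdx (a + 6).factorial := ⟨a + 6, by omega, rfl⟩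
    simp only [seqB, if_pos h]
    positivity

/-- `e^3 < 32` and `4 < e^2`, from Mathlib's decimal bounds on `e`. [folklore] -/
theorem exp_bounds : Real.exp 3 < 32 ∧ 4 < Real.exp 2 := by
  have h3 : Real.exp 3 = Real.exp 1 ^ 3 := by rw [← Real.exp_nat_mul]; norm_num
  have h2 : Real.exp 2 = Real.exp 1 ^ 2 := by rw [← Real.exp_nat_mul]; norm_num
  have lo := Real.exp_one_gt_d9
  have hi := Real.exp_one_lt_d9
  constructor
  · rw [h3]; nlinarith [Real.exp_pos 1]
  · rw [h2]; nlinarith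

/-- At an index `n = k!` the form is the small divisor: `A n + B n ℓ₂ = s k`, and the coefficients are
`|A n| = p k`, `|B n| = 2^n` with `den k = 2^n`. [folklore] -/
theorem at_idx {n : ℕ} (h : IsIdx n) :
    6 ≤ Classical.choose h ∧ (den (Classical.choose h) : ℝ) = 2 ^ n ∧
    (seqA n : ℝ) + seqB n * ell = sd (Classical.choose h) ∧
    |(seqA n : ℝ)| = num (Classical.choose h) ∧ |(seqB n : ℝ)| = 2 ^ n := by
  obtain ⟨hk, hkn⟩ := Classical.choose_spec h
  have hden : (den (Classical.choose h) : ℝ) = 2 ^ n := by rw [den, Nat.cast_pow, hkn]; norm_num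
  have hA : (seqA n : ℝ) = -(num (Classical.choose h) : ℝ) := by
    simp only [seqA, dif_pos h]; push_cast; ring
  have hB : (seqB n : ℝ) = 2 ^ n := by simp only [seqB, if_pos h]; push_cast; ring
  refine ⟨hk, hden, ?_, ?_, ?_⟩
  · rw [hA, hB, sd, hden]; ring
  · rw [hA, abs_neg, Nat.abs_cast]
  · rw [hB]; exact abs_of_pos (by positivity)

/-- The decay bound `|A n + B n ℓ₂| < e^{-3n}` for every `n`. [folklore] -/
theorem form_lt (n : ℕ) : |(seqA n : ℝ) + seqB n * ell| < Real.exp (-(3 * (n : ℝ))) := by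
  by_cases h : IsIdx n
  · obtain ⟨hk, hden, hform, -, -⟩ := at_idx h
    set k := Classical.choose h with hk_def
    have hn : n ≠ 0 := by
      obtain ⟨_, hkn⟩ := Classical.choose_spec h; rw [← hkn]; exact Nat.factorial_ne_zero _
    rw [hform, abs_of_pos (sd_pos k)]
    -- `s k < 1/(2^n)^(k-1) ≤ 1/(2^n)^5 = 1/32^n < 1/(e^3)^n = e^{-3n}`
    have h1 : sd k < 1 / ((2 : ℝ) ^ n) ^ (k - 1) := by simpa [hden] using sd_lt k (by omega)
    have h2 : 1 / ((2 : ℝ) ^ n) ^ (k - 1) ≤ 1 / ((2 : ℝ) ^ n) ^ 5 :=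
      one_div_le_one_div_of_le (by positivity)
        (pow_le_pow_right₀ (one_le_pow₀ (by norm_num : (1 : ℝ) ≤ 2)) (by omega))
    have h3 : ((2 : ℝ) ^ n) ^ 5 = 32 ^ n := by rw [← pow_mul, mul_comm, pow_mul]; norm_num
    have h4 : Real.exp 3 ^ n < (32 : ℝ) ^ n :=
      pow_lt_pow_left₀ exp_bounds.1 (Real.exp_pos 3).le hn
    have h5 : Real.exp (-(3 * (n : ℝ))) = 1 / Real.exp 3 ^ n := by
      rw [Real.exp_neg, ← Real.exp_nat_mul, mul_comm, one_div]
    rw [h5]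
    calc sd k < 1 / ((2 : ℝ) ^ n) ^ (k - 1) := h1
      _ ≤ 1 / ((2 : ℝ) ^ n) ^ 5 := h2
      _ = 1 / (32 : ℝ) ^ n := by rw [h3]
      _ < 1 / Real.exp 3 ^ n := one_div_lt_one_div_of_lt (by positivity) h4
  · simp only [seqA, seqB, dif_neg h, if_neg h, Int.cast_zero, zero_mul, add_zero, abs_zero]
    exact Real.exp_pos _

/-- The growth bound `max (|A n|, |B n|) < e^{2n}` for every `n`. [folklore] -/
theorem coeff_lt (n : ℕ) :
    max (|(seqA n : ℝ)|) (|(seqB n : ℝ)|) < Real.exp (2 * (n : ℝ)) := by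
  by_cases h : IsIdx n
  · obtain ⟨hk, hden, -, hA, hB⟩ := at_idx h
    set k := Classical.choose h with hk_def
    have hn : n ≠ 0 := by
      obtain ⟨_, hkn⟩ := Classical.choose_spec h; rw [← hkn]; exact Nat.factorial_ne_zero _
    have he : Real.exp (2 * (n : ℝ)) = Real.exp 2 ^ n := by rw [← Real.exp_nat_mul, mul_comm]
    have h4 : (4 : ℝ) ^ n < Real.exp 2 ^ n := pow_lt_pow_left₀ exp_bounds.2 (by norm_num) hn
    have h2n : (2 : ℝ) ≤ 2 ^ n := le_self_pow₀ (by norm_num) hn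
    have h44 : (4 : ℝ) ^ n = 2 ^ n * 2 ^ n := by rw [← mul_pow]; norm_num
    -- `|A n| = p k < 2 · 2^n ≤ 4^n`, `|B n| = 2^n < 4^n`
    have hA' : |(seqA n : ℝ)| < (4 : ℝ) ^ n := by
      rw [hA, h44]
      calc (num k : ℝ) < 2 * den k := num_lt k
        _ = 2 * 2 ^ n := by rw [hden]
        _ ≤ 2 ^ n * 2 ^ n := by gcongr
    have hB' : |(seqB n : ℝ)| < (4 : ℝ) ^ n := by
      rw [hB, h44]
      calc (2 : ℝ) ^ n = 1 * 2 ^ n := (one_mul _).symm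
        _ < 2 ^ n * 2 ^ n := by gcongr; linarith
    rw [he]
    exact max_lt (hA'.trans h4) (hB'.trans h4)
  · simp only [seqA, seqB, dif_neg h, if_neg h, Int.cast_zero, abs_zero, max_self]
    exact Real.exp_pos _

/-! ### The refutation -/

/-- **Liouville's constant satisfies the hypotheses of (Morris 2025, Theorem 2)** with
`γ_A = 3 > γ_B = 2 > 0`. [folklore] -/
theorem hyp_ell : Hyp ell 3 2 := by
  refine ⟨by norm_num, by norm_num, seqA, seqB, seqB_frequently_ne_zero, ?_⟩
  exact Eventually.of_forall fun n => ⟨form_lt n, coeff_lt n⟩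

/-- **(Morris 2025, Theorem 2) is false as stated (qualitative form):** its hypotheses, even with
`γ_A > γ_B`, do not exclude Liouville numbers. [folklore] -/
theorem not_not_liouville_of_hyp :
    ¬ ∀ α γA γB : ℝ, γB < γA → Hyp α γA γB → ¬ Liouville α := fun h =>
  h ell 3 2 (by norm_num) hyp_ell liouville_ell

/-- **(Morris 2025, Theorem 2) is false as stated (quantitative form):** the asserted bound
`μ(α) ≤ γ_A/(γ_A - γ_B)` (tree: `ExponentLE α (γA / (γA - γB))`) fails for `α = ℓ₂`, `γ_A = 3`,
`γ_B = 2`, already at the exponent `p = 4 > 3`. [folklore] -/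
theorem not_exponentLE_of_hyp :
    ¬ ∀ α γA γB : ℝ, γB < γA → Hyp α γA γB → ExponentLE α (γA / (γA - γB)) := fun h =>
  h ell 3 2 (by norm_num) hyp_ell 4 (by norm_num) (liouville_ell.liouvilleWith 4)

/-- The same two refutations packaged positively: a real number satisfying the printed hypotheses with
`γ_A = 3 > γ_B = 2` and Liouville (so `p`-Liouville for every `p`). [folklore] -/
theorem exists_hyp_and_liouville : ∃ α : ℝ, Hyp α 3 2 ∧ Liouville α := ⟨ell, hyp_ell, liouville_ell⟩

/-- What survives: the hypotheses DO give `LiouvilleWith`-type information in the useless direction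
only — they exhibit good approximations, i.e. they bound `μ(α)` from BELOW when the `A n / B n` are
distinct, never from above.  Recorded as the trivial remark that `Hyp` is compatible with every
exponent: `Hyp ℓ₂ 3 2 ∧ ∀ p, LiouvilleWith p ℓ₂`. [folklore] -/
theorem hyp_and_liouvilleWith : Hyp ell 3 2 ∧ ∀ p : ℝ, LiouvilleWith p ell :=
  ⟨hyp_ell, fun p => liouville_ell.liouvilleWith p⟩

end SparseForms

end Summit.KontsevichZagierPeriods.Zeta5Search
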